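import Literature.NumberTheory.EllipticCurves.Smith2016.CongruentNumberBSDSelmerRankTwo
import Literature.NumberTheory.EllipticCurves.BSDSelmerCMPConverseBSDTripleProofs
import Literature.NumberTheory.EllipticCurves.BSDSelmerCMPConverseRankOneProofs
import Literature.NumberTheory.EllipticCurves.BSDRankZeroDensityProofs
import HarnessLib

/-!
# Smith 2016, Cor. 1.3 (PRE) follows from Burungale–Tian 2026 + Burungale–Flach 2024 (refereed)

Sibling *proofs* file (theorems only: no definition, no named fact, no instance) of
`Literature.NumberTheory.EllipticCurves.Smith2016.CongruentNumberBSDSelmerRankTwo`, whose named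
fact `Smith2016.cor13_bsd_of_selmerRankTwo` transcribes A. Smith, *The congruent numbers have
positive natural density*, arXiv:1603.08479 (2016), **Cor. 1.3** (first sentence): for positive
squarefree `n` with `#Sel^{(2)}(E^{(n)}/ℚ) = 4`, the congruent number curve
`E^{(n)} : y² = x³ − n²x` satisfies the full Birch–Swinnerton-Dyer statement (`BSDTriple`). The
source is an arXiv PREPRINT (its own proof: Tian–Yuan–Zhang's parity of `𝓛`, Monsky matrices,
Rubin's main conjecture for odd `p`, Waldspurger).

This file proves that the SAME statement is a consequence of two REFEREED theorems, both nodes of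
the tree as named facts and both admitting the prime `2`:

* `burungaleTian_analyticRank_eq_zero_of_selmerCorank_eq_zero_of_hasCM` — Burungale–Tian, Ann. of
  Math. (2) 203 (2026) Thm. 1.1 ("Let `p` be a prime"; applied by the authors themselves at `p = 2`
  to `E^{(n)}: ny² = x³ − x`, proof of their Thm. 1.2): CM and `corank_{ℤ_p} Sel_{p^∞}(E/ℚ) = 0`
  give `ord_{s=1} L(E, s) = 0`;
* `bsdTriple_of_hasCM_of_L_one_ne_zero` (bsd.S28) — Burungale–Flach, Camb. J. Math. 12 (2024)
  Cor. 2 with the sentence "Any CM elliptic curve `E/ℚ` with `L(E/ℚ,1) ≠ 0` satisfies the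
  assumptions of Corollary 2" and their Cor. 3 (the congruent number family itself);

through the composition `bsdTriple_of_hasCM_of_mordellWeilRank_eq_zero_of_finite_shaPrimary`
(`BSDSelmerCMPConverseBSDTripleProofs`: CM + `rank E(ℚ) = 0` + `Ш(E/ℚ)[p^∞]` finite at ONE prime
⟹ `BSDTriple`, via Deuring–Hecke `hasEntireLFunction_of_j_mem_maximalCMJInvariants`) and the
descent count `#Sel^{(2)} = 2^{rank} · #E(ℚ)[2] · #Ш[2]` (Silverman X.4.2;
`WeierstrassCurve.natCard_selmerGroup_eq`): with `#E^{(n)}(ℚ)[2] = 4`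
(`Smith2016.natCard_torsionBy_two_congruentNumberCurve`) the hypothesis `#Sel^{(2)} = 4` forces
`rank = 0` (`Smith2016.mordellWeilRank_eq_zero_of_card_selmerGroup_two`) and `Ш[2] = 0`, hence
`Ш[2^∞] = 0` (`primaryComponent_sha_eq_bot_of_inf_torsionBy_eq_bot`).

Statements:
* `Smith2016.primaryComponent_sha_two_eq_bot_of_card_selmerGroup_two` — `#Sel^{(2)}(E^{(n)}) = 4`
  ⟹ `Ш(E^{(n)}/ℚ)[2^∞] = 0` (tree theorems only);
* `Smith2016.cor13_bsd_of_selmerRankTwo_of_burungaleTian_of_burungaleFlach` — the named fact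
  `cor13_bsd_of_selmerRankTwo` from `hBT`, `hH` (Deuring–Hecke), `hBF`;
* `Smith2016.cor13_bsd_of_selmerRankTwo_of_burungaleTian_of_burungaleFlach_of_hasEntireLFunction_rat`
  — the same with the modularity leaf `hasEntireLFunction_rat` in place of Deuring–Hecke.

So the registry tier of Cor. 1.3 (PRE) is immaterial for consumers: `(h : cor13_bsd_of_selmerRankTwo)`
is supplied by `cor13_bsd_of_selmerRankTwo_of_burungaleTian_of_burungaleFlach hBT hH hBF` from
refereed facts. Nothing here is specific to Smith's family beyond `j = 1728` (CM) and full rational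
`2`-torsion; the general statement is `bsdTriple_of_hasCM_of_mordellWeilRank_eq_zero_of_finite_shaPrimary`.

References: A. Smith, arXiv:1603.08479, Cor. 1.3; A. A. Burungale, Y. Tian, Ann. of Math. (2) 203
(2026), Thm. 1.1 and proof of Thm. 1.2; A. Burungale, M. Flach, Camb. J. Math. 12 (2024), Cor. 2,
Cor. 3; J. H. Silverman, *AEC*, Thm. X.4.2.
-/

noncomputable section

open scoped Classical AddSubgroup

open WeierstrassCurve Literature.NumberTheory.EllipticCurves

namespace Literature.NumberTheory.EllipticCurves.Smith2016

/-- **`#Sel^{(2)}(E^{(n)}/ℚ) = 4 ⟹ Ш(E^{(n)}/ℚ)[2^∞] = 0`** (`n ≠ 0`): the descent count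
`#Sel^{(2)} = 2^{rank} · #E(ℚ)[2] · #(Ш ⊓ H¹(ℚ,E)[2])` (`WeierstrassCurve.natCard_selmerGroup_eq`,
Silverman X.4.2(a)) with `rank = 0` (`mordellWeilRank_eq_zero_of_card_selmerGroup_two`) and
`#E^{(n)}(ℚ)[2] = 4` (`natCard_torsionBy_two_congruentNumberCurve`) leaves `#Ш[2] = 1`, and a
`2`-primary group without `2`-torsion is trivial
(`primaryComponent_sha_eq_bot_of_inf_torsionBy_eq_bot`). [cite: SilvermanAEC2009, Thm. X.4.2] -/
theorem primaryComponent_sha_two_eq_bot_of_card_selmerGroup_two {n : ℕ} (hn : n ≠ 0)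
    (h : Nat.card ((congruentNumberCurve n).selmerGroup 2) = 4) :
    haveI := isElliptic_congruentNumberCurve hn
    AddCommGroup.primaryComponent (congruentNumberCurve n).sha 2 = ⊥ := by
  haveI := isElliptic_congruentNumberCurve hn
  haveI : Fact (Nat.Prime 2) := ⟨Nat.prime_two⟩
  have hr : (congruentNumberCurve n).mordellWeilRank = 0 :=
    mordellWeilRank_eq_zero_of_card_selmerGroup_two hn h
  have hsel : Nat.card ((congruentNumberCurve n).selmerGroup ((2 : ℕ) : ℤ)) = 4 := by
    simpa only [Nat.cast_ofNat] using h
  -- the descent count `#Sel^(2) = 2^rank · #E(ℚ)[2] · #(Ш ⊓ H¹(ℚ,E)[2])` (Silverman X.4.2(a))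
  have hcard := (congruentNumberCurve n).natCard_selmerGroup_eq (n := 2) two_ne_zero
  rw [hsel, hr, pow_zero, one_mul] at hcard
  -- `4 = #E(ℚ)[2] · #(Ш ⊓ H¹(ℚ,E)[2])` with `#E(ℚ)[2] = 4`; the generic count carries the classical
  -- `DecidableEq` on the base field inside `E(ℚ)`, bridged by `convert` (a subsingleton)
  have aux : ∀ {T S : ℕ}, 4 = T * S → T = 4 → S = 1 := by
    intro T S hTS hT
    subst hT
    omega
  have hone := aux hcard (by convert natCard_torsionBy_two_congruentNumberCurve hn; norm_num)
  exact primaryComponent_sha_eq_bot_of_inf_torsionBy_eq_bot (congruentNumberCurve n) 2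
    (AddSubgroup.eq_bot_of_card_eq _ hone)

/-- **Smith 2016, Cor. 1.3 from refereed facts**: the named fact `cor13_bsd_of_selmerRankTwo`
(arXiv:1603.08479 Cor. 1.3, a preprint) follows from Burungale–Tian, Ann. of Math. 203 (2026)
Thm. 1.1 at `p = 2` (`hBT`), the Deuring–Hecke continuation (`hH`) and Burungale–Flach, Camb. J.
Math. 12 (2024) Cor. 2 (`hBF` = bsd.S28): `#Sel^{(2)}(E^{(n)}) = 4` gives `rank E^{(n)}(ℚ) = 0` and
`Ш(E^{(n)}/ℚ)[2^∞] = 0`, and `E^{(n)}` has CM by `ℤ[i]` (`LiLiuTian2024.hasCM_congruentNumberCurve`),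
so `bsdTriple_of_hasCM_of_mordellWeilRank_eq_zero_of_finite_shaPrimary` applies at `p = 2`.
[cite: Smith2016CongruentDensity, Cor. 1.3] [cite: BurungaleTian2026, Thm. 1.1]
[cite: BurungaleFlach2024, Thm 1.1 and Cor. 2] -/
theorem cor13_bsd_of_selmerRankTwo_of_burungaleTian_of_burungaleFlach
    (hBT : burungaleTian_analyticRank_eq_zero_of_selmerCorank_eq_zero_of_hasCM)
    (hH : hasEntireLFunction_of_j_mem_maximalCMJInvariants)
    (hBF : bsdTriple_of_hasCM_of_L_one_ne_zero) :
    cor13_bsd_of_selmerRankTwo := by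
  intro n _ _ hsq hsel
  have hn : n ≠ 0 := Squarefree.ne_zero hsq
  haveI : Fact (Nat.Prime 2) := ⟨Nat.prime_two⟩
  have hbot := primaryComponent_sha_two_eq_bot_of_card_selmerGroup_two hn hsel
  have hfin : Finite (AddCommGroup.primaryComponent (congruentNumberCurve n).sha 2) := by
    rw [hbot]; infer_instance
  exact bsdTriple_of_hasCM_of_mordellWeilRank_eq_zero_of_finite_shaPrimary hBT hH hBF
    (congruentNumberCurve n) (LiLiuTian2024.hasCM_congruentNumberCurve n) 2
    (mordellWeilRank_eq_zero_of_card_selmerGroup_two hn hsel) hfin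

/-- `cor13_bsd_of_selmerRankTwo_of_burungaleTian_of_burungaleFlach` with the modularity leaf
`hasEntireLFunction_rat` in place of the Deuring–Hecke leaf.
[cite: Smith2016CongruentDensity, Cor. 1.3] [cite: BurungaleTian2026, Thm. 1.1]
[cite: BurungaleFlach2024, Thm 1.1 and Cor. 2] [cite: BCDTJAMS2001, Theorem A] -/
theorem cor13_bsd_of_selmerRankTwo_of_burungaleTian_of_burungaleFlach_of_hasEntireLFunction_rat
    (hBT : burungaleTian_analyticRank_eq_zero_of_selmerCorank_eq_zero_of_hasCM)
    (hmod : hasEntireLFunction_rat) (hBF : bsdTriple_of_hasCM_of_L_one_ne_zero) :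
    cor13_bsd_of_selmerRankTwo :=
  cor13_bsd_of_selmerRankTwo_of_burungaleTian_of_burungaleFlach hBT
    (hasEntireLFunction_of_j_mem_maximalCMJInvariants_of_hasEntireLFunction_rat hmod) hBF

end Literature.NumberTheory.EllipticCurves.Smith2016

end
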